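import Summits.Ventures.PackingBounds.Configurations.LeechCard4600
import Summits.Ventures.PackingBounds.SphericalCodes.Dim23N4600Rigidity
import Summits.Ventures.PackingBounds.Energy.UniversalOptimality

/-!
# Rigidity of `4600`-point `arccos(1/3)`-codes in `ℝ²³`: distance distribution and ground-state energy

Framing: lottery ticket; floor = certified bounds/negative ranges. Venture `PackingBounds` (cell
`pub-packcert`, seat `pub-packcert-energy`).

Let `C ⊂ S²²` have pairwise inner products `≤ 1/3` and `|C| = 4600` (e.g. the Leech neighbours of
`Configurations/LeechCard4600.lean`). The sharp Delsarte certificate `f(t) = (t+1)(t+1/3)²t²(t-1/3)` (degree `6`,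
all Gegenbauer coefficients `> 0`) gives by complementary slackness: inner products of distinct points lie in
`{-1, -1/3, 0, 1/3}` (tree: `SphericalCodes.code_dim23_inner_of_card_eq_4600`) and the Gegenbauer moments of
orders `1…6` vanish (`moments_of_card_eq_4600`, this file, via
`DelsarteLP.sum_sum_gegenbauerSum_eq_zero_of_card_mul_eq_coord`). The four pair counts then solve a
nonsingular `4 × 4` system: `4600 · (1, 891, 2816, 891)` ordered pairs at `-1, -1/3, 0, 1/3` (`pairCount23_eq`),
so the `a`-energy of every such `C` is `4600 (a(-1) + 891 a(-1/3) + 2816 a(0) + 891 a(1/3))` for EVERY `a`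
(`energy_eq_of_card_eq_4600`). With the cell's universal-optimality bound (`Energy.UniversalDim23Card4600`)
this closes the **ground-state energy of `4600` points on `S²²`** (`energy23_isLeast`) — the `(23, 4600)` row of
Cohn–Kumar's Table 1, two-sided.

## References
* E. Bannai, N. J. A. Sloane, Canad. J. Math. 33 (1981) 437–449; Conway–Sloane *SPLAG* Ch. 14. [`ConwaySloane1999`]
* H. Cohn, A. Kumar, J. Amer. Math. Soc. 20 (2007) 99–148, Theorem 1.2, Table 1. [`CohnKumar2006`]
-/

namespace Summit.Ventures.PackingBounds.Config.Leech

open Finset Literature.Analysis.SpecialFunctions Literature.Geometry.DiscreteGeometry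

local notation "E23" => EuclideanSpace ℝ (Fin 23)

/-- Number of ordered pairs of distinct points of `C ⊂ ℝ²³` with inner product `t`. -/
noncomputable def pairCount23 (C : Finset E23) (t : ℝ) : ℕ :=
  ((C ×ˢ C).filter fun p => p.1 ≠ p.2 ∧ inner ℝ p.1 p.2 = t).card

/-- The four inner products. -/
noncomputable def T4 : Finset ℝ := {-1, -1 / 3, 0, 1 / 3}

/-- A sum over `T4`, written out. -/
theorem sum_T4 (F : ℝ → ℝ) : ∑ t ∈ T4, F t = F (-1) + F (-1 / 3) + F 0 + F (1 / 3) := by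
  simp only [T4]
  rw [sum_insert (by norm_num), sum_insert (by norm_num), sum_insert (by norm_num), sum_singleton]
  ring

/-- Energy sums as sums over ordered pairs of distinct points. -/
theorem sum_erase_eq_sum_offDiag23 (C : Finset E23) (f : E23 → E23 → ℝ) :
    ∑ x ∈ C, ∑ y ∈ C.erase x, f x y = ∑ p ∈ (C ×ˢ C).filter (fun p => p.1 ≠ p.2), f p.1 p.2 := by
  rw [Finset.sum_filter, Finset.sum_product]
  refine Finset.sum_congr rfl fun x _ => ?_
  rw [← Finset.filter_ne C x, Finset.sum_filter]

/-- `C_1^{(21/2)}` explicitly. -/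
theorem gegenbauerSum_212_1 (t : ℝ) : gegenbauerSum (21 / 2) 1 t = 21 * t := by
  simp [gegenbauerSum, gegenbauerCoeff, Nat.factorial]; ring

/-- `C_2^{(21/2)}` explicitly. -/
theorem gegenbauerSum_212_2 (t : ℝ) : gegenbauerSum (21 / 2) 2 t = 483 / 2 * t ^ 2 - 21 / 2 := by
  simp [gegenbauerSum, gegenbauerCoeff, Finset.sum_range_succ, Finset.prod_range_succ, Nat.factorial]; ring

/-- `C_3^{(21/2)}` explicitly. -/
theorem gegenbauerSum_212_3 (t : ℝ) : gegenbauerSum (21 / 2) 3 t = 4025 / 2 * t ^ 3 - 483 / 2 * t := by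
  simp [gegenbauerSum, gegenbauerCoeff, Finset.sum_range_succ, Finset.prod_range_succ, Nat.factorial]; ring

/-- **Design property of a `4600`-point `arccos(1/3)`-code in `ℝ²³`**: for `1 ≤ k ≤ 6` the Gegenbauer moment
`Σ_{x,y ∈ C} C_k^{(21/2)}(⟨x,y⟩)` vanishes (complementary slackness for the sharp degree-`6` certificate).
[cite: ConwaySloane1999, Ch. 14 §§2–3] -/
theorem moments_of_card_eq_4600 (C : Finset E23)
    (h1 : ∀ x ∈ C, ‖x‖ = 1) (h2 : ∀ x ∈ C, ∀ y ∈ C, x ≠ y → inner ℝ x y ≤ 1 / 3)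
    (hcard : C.card = 4600) {k : ℕ} (hk1 : 1 ≤ k) (hk2 : k ≤ 6) :
    ∑ x ∈ C, ∑ y ∈ C, gegenbauerSum (21 / 2 : ℝ) k (inner ℝ x y) = 0 := by
  classical
  have hpoly : ∀ t : ℝ, ∑ k ∈ range (6 + 1),
      (fun k => match k with
      | 0 => 8 / 15525 | 1 => 8 / 14175 | 2 => 328 / 1134567 | 3 => 488 / 3151575
      | 4 => 1576 / 30320325 | 5 => 32 / 1890945 | 6 => 16 / 6513255 | _ => 0) k * gegenbauerSum ((21 / 2) : ℝ) k t =
      (t + 1) * ((t + 1 / 3) ^ 2 * t ^ 2) * (t - 1 / 3) := by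
    intro t
    simp [Finset.sum_range_succ, gegenbauerSum, gegenbauerCoeff, Finset.prod_range_succ, Nat.factorial]
    ring
  have hinner : ∀ a b : E23, inner ℝ a b = ∑ j, a j * b j := fun a b => by
    simp [PiLp.inner_apply, mul_comm]
  have key := DelsarteLP.sum_sum_gegenbauerSum_eq_zero_of_card_mul_eq_coord (n := 23) (μ := (21 / 2))
    (by norm_num) (by norm_num) 6
    (fun k => match k with
      | 0 => 8 / 15525 | 1 => 8 / 14175 | 2 => 328 / 1134567 | 3 => 488 / 3151575
      | 4 => 1576 / 30320325 | 5 => 32 / 1890945 | 6 => 16 / 6513255 | _ => 0)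
    ?_ (1 / 3) ?_ (ι := C) (fun a j => (a : E23) j) ?_ ?_ ?_
    (k := k) (Finset.mem_range.2 (by omega)) hk1 ?_
  · have hco : ∑ x ∈ C, ∑ y ∈ C, gegenbauerSum (21 / 2 : ℝ) k (inner ℝ x y) =
        ∑ a : C, ∑ b : C, gegenbauerSum (21 / 2 : ℝ) k (∑ j, (a : E23) j * (b : E23) j) := by
      rw [← Finset.sum_coe_sort C]
      refine Finset.sum_congr rfl fun a _ => ?_
      rw [← Finset.sum_coe_sort C]
      refine Finset.sum_congr rfl fun b _ => ?_
      rw [hinner]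
    rw [hco]
    exact key
  · intro k
    split <;> norm_num
  · intro t ht1 ht2
    rw [hpoly]
    exact mul_nonpos_of_nonneg_of_nonpos (mul_nonneg (by linarith) (by positivity)) (by linarith)
  · intro a
    rw [← EuclideanSpace.real_norm_sq_eq, h1 a a.2, one_pow]
  · intro a b hab
    have hne : (a : E23) ≠ b := fun h => hab (Subtype.ext h)
    have h := h2 a a.2 b b.2 hne
    rwa [hinner] at h
  · rw [Fintype.card_coe, hcard]
    norm_num [Finset.sum_range_succ, gegenbauerSum, gegenbauerCoeff, Finset.prod_range_succ, Nat.factorial]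
  · interval_cases k <;> norm_num

section rigidity

variable {C : Finset E23} (h1 : ∀ x ∈ C, ‖x‖ = 1)
  (h2 : ∀ x ∈ C, ∀ y ∈ C, x ≠ y → inner ℝ x y ≤ 1 / 3) (hcard : C.card = 4600)
include h1 h2 hcard

/-- Every energy sum of a `4600`-point `arccos(1/3)`-code in `ℝ²³` is a combination of the four pair counts. -/
theorem energy23_eq_sum_pairCount (g : ℝ → ℝ) :
    ∑ x ∈ C, ∑ y ∈ C.erase x, g (inner ℝ x y) = ∑ t ∈ T4, (pairCount23 C t : ℝ) * g t := by
  rw [sum_erase_eq_sum_offDiag23]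
  have hmaps : ∀ p ∈ (C ×ˢ C).filter (fun p => p.1 ≠ p.2), inner ℝ p.1 p.2 ∈ T4 := by
    intro p hp
    simp only [mem_filter, mem_product] at hp
    have h := SphericalCodes.code_dim23_inner_of_card_eq_4600 C h1 h2 hcard hp.1.1 hp.1.2 hp.2
    simp only [T4, mem_insert, mem_singleton]
    rcases h with h | h | h | h <;> simp [h]
  rw [← Finset.sum_fiberwise_of_maps_to hmaps]
  refine Finset.sum_congr rfl fun t _ => ?_
  have hpc : pairCount23 C t = (((C ×ˢ C).filter (fun p => p.1 ≠ p.2)).filter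
      fun p => inner ℝ p.1 p.2 = t).card := by
    rw [pairCount23, Finset.filter_filter]
  rw [hpc, ← nsmul_eq_mul, ← Finset.sum_const]
  exact Finset.sum_congr rfl fun p hp => by rw [(Finset.mem_filter.mp hp).2]

/-- Off-diagonal Gegenbauer moments of orders `1 ≤ k ≤ 6`. -/
theorem moment23_erase {k : ℕ} (hk1 : 1 ≤ k) (hk2 : k ≤ 6) :
    ∑ x ∈ C, ∑ y ∈ C.erase x, gegenbauerSum (21 / 2) k (inner ℝ x y) = -(4600 * gegenbauerSum (21 / 2) k 1) := by
  have h := moments_of_card_eq_4600 C h1 h2 hcard hk1 hk2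
  have hsplit : ∀ x ∈ C, ∑ y ∈ C, gegenbauerSum (21 / 2) k (inner ℝ x y) =
      gegenbauerSum (21 / 2) k 1 + ∑ y ∈ C.erase x, gegenbauerSum (21 / 2) k (inner ℝ x y) := by
    intro x hx
    rw [← Finset.add_sum_erase C _ hx, real_inner_self_eq_norm_sq, h1 x hx, one_pow]
  rw [Finset.sum_congr rfl hsplit, Finset.sum_add_distrib, Finset.sum_const, hcard, nsmul_eq_mul] at h
  push_cast at h
  linarith

/-- **The distance distribution of a `4600`-point `arccos(1/3)`-code in `ℝ²³` is forced**:
`4600 · (1, 891, 2816, 891)` ordered pairs at inner products `-1, -1/3, 0, 1/3`. [cite: CohnKumar2006, Table 1] -/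
theorem pairCount23_eq :
    pairCount23 C (-1) = 4600 ∧ pairCount23 C (-1 / 3) = 4098600 ∧ pairCount23 C 0 = 12953600 ∧
      pairCount23 C (1 / 3) = 4098600 := by
  have e0 := energy23_eq_sum_pairCount h1 h2 hcard (fun _ => (1 : ℝ))
  have e0' : ∑ x ∈ C, ∑ y ∈ C.erase x, (fun _ => (1 : ℝ)) (inner ℝ x y) = 4600 * 4599 := by
    have : ∀ x ∈ C, ∑ y ∈ C.erase x, (fun _ => (1 : ℝ)) (inner ℝ x y) = 4599 := by
      intro x hx
      rw [Finset.sum_const, Finset.card_erase_of_mem hx, hcard]; norm_num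
    rw [Finset.sum_congr rfl this, Finset.sum_const, hcard]; norm_num
  have e1 := energy23_eq_sum_pairCount h1 h2 hcard (gegenbauerSum (21 / 2) 1)
  have e2 := energy23_eq_sum_pairCount h1 h2 hcard (gegenbauerSum (21 / 2) 2)
  have e3 := energy23_eq_sum_pairCount h1 h2 hcard (gegenbauerSum (21 / 2) 3)
  rw [moment23_erase h1 h2 hcard (by norm_num) (by norm_num)] at e1 e2 e3
  rw [e0'] at e0
  rw [sum_T4] at e0 e1 e2 e3
  simp only [gegenbauerSum_212_1, gegenbauerSum_212_2, gegenbauerSum_212_3] at e1 e2 e3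
  set a := (pairCount23 C (-1) : ℝ) with ha
  set b := (pairCount23 C (-1 / 3) : ℝ) with hb
  set c := (pairCount23 C 0 : ℝ) with hc
  set d := (pairCount23 C (1 / 3) : ℝ) with hd
  norm_num at e0 e1 e2 e3
  have ra : a = 4600 := by
    linear_combination (1 / 2100) * e1 + (9 / 16100) * e3
  have rb : b = 4098600 := by
    linear_combination (-9 / 46) * e0 + (12 / 175) * e1 + (-3 / 161) * e2 + (-27 / 8050) * e3
  have rc : c = 12953600 := by
    linear_combination (-14 / 23) * e0 + (2 / 525) * e1 + (6 / 161) * e2 + (18 / 4025) * e3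
  have rd : d = 4098600 := by
    linear_combination (-9 / 46) * e0 + (-51 / 700) * e1 + (-3 / 161) * e2 + (-27 / 16100) * e3
  rw [ha] at ra; rw [hb] at rb; rw [hc] at rc; rw [hd] at rd
  exact ⟨by exact_mod_cast ra, by exact_mod_cast rb, by exact_mod_cast rc, by exact_mod_cast rd⟩

/-- **The energy of every `4600`-point `arccos(1/3)`-code in `ℝ²³` is that of the Leech neighbours**, for
every pair potential `a`. [cite: CohnKumar2006, Table 1] -/
theorem energy_eq_of_card_eq_4600 (a : ℝ → ℝ) :
    ∑ x ∈ C, ∑ y ∈ C.erase x, a (inner ℝ x y) =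
      4600 * (a (-1) + 891 * a (-1 / 3) + 2816 * a 0 + 891 * a (1 / 3)) := by
  rw [energy23_eq_sum_pairCount h1 h2 hcard a, sum_T4]
  obtain ⟨c1, c2, c3, c4⟩ := pairCount23_eq h1 h2 hcard
  rw [c1, c2, c3, c4]
  push_cast
  ring

end rigidity

/-- **Ground-state energy of `4600` points on `S²²`.** For every potential `a` absolutely monotonic on `[-1,1)`,
the least `a`-energy of a `4600`-point configuration of unit vectors of `ℝ²³` is
`4600 (a(-1) + 891 a(-1/3) + 2816 a(0) + 891 a(1/3))`, attained by the Leech neighbours (universal optimality,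
Cohn–Kumar 2007 Thm 1.2: lower bound kernel-checked in `Energy/UniversalOptimalityDim23Card4600`; attained
side: `LeechCard4600.exists_code_4600` + the rigidity count of this file). [cite: CohnKumar2006, Theorem 1.2] -/
theorem energy23_isLeast (a : ℝ → ℝ) (ha : AbsolutelyMonotoneOn a (Set.Ico (-1) 1)) :
    IsLeast {E : ℝ | ∃ C : Finset E23, (∀ x ∈ C, ‖x‖ = 1) ∧ C.card = 4600 ∧
      E = ∑ x ∈ C, ∑ y ∈ C.erase x, a (inner ℝ x y)}
      ((4600 : ℝ) * (a (-1) + 891 * a (-1 / 3) + 2816 * a (0) + 891 * a (1 / 3))) := by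
  obtain ⟨C, hc, hn, hi⟩ := exists_code_4600
  refine ⟨⟨C, hn, hc, (energy_eq_of_card_eq_4600 hn hi hc a).symm⟩, ?_⟩
  rintro E ⟨C', h1, hN, rfl⟩
  exact Energy.UniversalDim23Card4600.universallyOptimal_of_absolutelyMonotoneOn a ha C' h1 hN

end Summit.Ventures.PackingBounds.Config.Leech
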